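import Literature.MathematicalPhysics.QuantumLattice.TorusGibbsKMSMomentCuts
import HarnessLib

/-!
# KMS moment cuts, IV: the KMS moment rows of thermal torus-limit states of the `t–t'` Hubbard model

Topic `Literature/MathematicalPhysics/QuantumLattice`; thermodynamic-limit packaging of
`GibbsKMSMomentCuts(Sector).lean` / `TorusGibbsKMSMomentCuts.lean`, completing for every order `K` what
`TorusGibbsMatrixCuts.lean` does for `K = 1`. For a region `Λ`, local generators `a_i ∈ 𝔄_Λ` conserving the
local particle number and `S^z`, a WINDOW `Λ' ⊇ (thicken · 1)^[K] Λ` (the `K`-th king-move shell of `Λ`,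
so that all iterated commutators `ad_{H_{Λ'}}^k(Γa_j)`, `k ≤ K`, with the free-boundary `t–t'–U` Hamiltonian
`H_{Λ'} = (hubbardTTPrimeFermionInteraction t t' U).localHamiltonian Λ'` are the true derivation powers
`δ^k(a_j)`), and coefficient matrices `P_k, Q_k` with

  `Σ_k u^k P_k + e^{−u} Σ_k u^k Q_k ⪰ 0` for every real `u`,

the local KMS MOMENT CUT

  `R = Σ_k Σ_{ij} β^k [(P_k)_{ij} · (Γa_i)ᴴ ad_{H_{Λ'}}^k(Γa_j) + (Q_k)_{ij} · ad_{H_{Λ'}}^k(Γa_j) (Γa_i)ᴴ]`,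
  `Γ = Γ_{Λ⊆Λ'}`,

satisfies `0 ≤ Re ω_{Λ'}(R)` for every torus limit `ω` of the canonical sector Gibbs states
(`sectorGibbsWeightTT'`, `sectorGibbsVectorTT'` on `(rectN n L, S^z = 0)`) at inverse temperature `β`
along `Ls → ∞` (`IsTorusLimitOfMixture.re_expect_momentCut_nonneg_of_sectorGibbs`, §2), and so does every
SCALAR KMS moment row `Σ_k β^k [p_k · (Γa)ᴴ ad^k(Γa) + q_k · ad^k(Γa)(Γa)ᴴ]` with
`0 ≤ Σ_k p_k u^k + e^{−u} Σ_k q_k u^k` on `ℝ` (`…re_expect_momentRow_nonneg_of_sectorGibbs`). §1 is the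
finite-volume step: the translation average over the torus of the embedded local cut is nonnegative in
the canonical Gibbs mixture (`re_sum_sectorGibbsWeightTT'_mul_torusAvgExpectAt_momentCut_nonneg`; pull-back
`ad_{H_L}^k(ΓΓa) = Γ(ad_{H_{Λ'}}^k Γa)` of `TorusGibbsKMSMomentCuts`, then the translated-mixture inequality).

These are the «KMS moment rows» of a thermal state relaxation (every linear β-KMS constraint on the
two-sided spectral moment data of the generators; Itoi–Ishimori–Sato–Sakamoto-type correlation
inequalities for `m = 1`), valid for the tree's torus-limit thermal object with gauge-invariant generators
and no hypothesis on `β, t, t', U, n`; what a reader must certify per row is the one-parameter semidefinite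
(for `m = 1`: scalar) condition on the WHOLE real line. Everything is PROVED; no definition, no named fact.

## Mathlib / tree search

REUSED: `sum_sectorGibbsWeightTT'_mul_re_expect_momentCut_fockTranslate_nonneg`,
`iterate_hubbardTorusTT'_commutator_fermionEmbed`, `iterate_thicken_one_subset_of_le` (`TorusGibbsKMSMomentCuts`),
`momentCut_unit_eq`, `posSemidef_momentCut_unit_of_nonneg` (`GibbsKMSMomentCutsSector`),
`commute_fermionEmbed_toTorusEmb_totalNumber/spinZ`, `torusAvgExpectAt_of_injOn`, `torusAvgExpect_eq`,
`eventually_injOn_proj_of_tendsto`, `fermionEmbed_fermionEmbed/congr/sum/add/smul/mul/conjTranspose`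
(`InfVolFermionState` & co.). `lean search 'momentCut|momentRow'`: only the companion files (2026-08-27).

## References

* C. Itoi, H. Ishimori, K. Sato, Y. Sakamoto, J. Phys. Soc. Jpn. 92 (2023) 074001 = arXiv:2306.03489, §2–§3.
  [cite: ItoiEtAl2023, Theorem 3]
* H. Fawzi, O. Fawzi, S. O. Scalet, Nat. Commun. 15 (2024) 7394 = arXiv:2311.18706, §3.1–§3.2 (KMS
  constraints of the certified relaxation, (opt2)). [cite: FawziFawziScalet2024, Thm. 3.4]
* O. Bratteli, D. W. Robinson, *OAQSM 2* (1997), Thm. 5.3.15, Thm. 6.2.4. [cite: BratteliRobinsonII1997, Thm. 5.3.15]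
-/

noncomputable section

namespace Literature.MathematicalPhysics.QuantumLattice

open Matrix Finset HubbardWave0 Literature.Probability.LatticeModels ThermodynamicLimit
open _root_.Filter
open scoped _root_.Topology ComplexOrder BigOperators

/-! ### §1 Translation averages of the embedded local KMS moment cuts -/

section TorusAverage

variable (L : ℕ) [NeZero L] (t t' U : ℝ) {m : Type*} [Fintype m]

/-- **The KMS moment cut of local generators, averaged over the torus translations, is nonnegative in the
canonical Gibbs mixture.** For a region `Λ`, a window `Λ' ⊇ Λ` containing `(thicken · 1)^[K] Λ` with
`x ↦ x mod L` injective on `thicken Λ' 1`, generators `a_i ∈ 𝔄_Λ` conserving the local `N` and `S^z`,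
`Γ = Γ_{Λ⊆Λ'}`, `H_{Λ'}` the free-boundary `t–t'–U` Hamiltonian of `Λ'`, and coefficient matrices with
`Σ_k u^k P_k + e^{−u} Σ_k u^k Q_k ⪰ 0` for all real `u`:
`0 ≤ Re Σ_c p_{L,c} · torusAvgExpectAt L Λ' (Σ_k Σ_{ij} β^k [(P_k)_{ij} (Γa_i)ᴴ ad_{H_{Λ'}}^k(Γa_j) +
(Q_k)_{ij} ad_{H_{Λ'}}^k(Γa_j)(Γa_i)ᴴ]) ψ_{L,c}`. [cite: FawziFawziScalet2024, Thm. 3.4] [cite: ItoiEtAl2023, Lemma 5] -/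
theorem re_sum_sectorGibbsWeightTT'_mul_torusAvgExpectAt_momentCut_nonneg (n β : ℝ) {Λ Λ' : Finset (Site 2)}
    (hΛ : Λ ⊆ Λ') {K : ℕ} (hK : (fun S : Finset (Site 2) => thicken S 1)^[K] Λ ⊆ Λ')
    (hInj : Set.InjOn (Torus.proj (d := 2) L) ↑(thicken Λ' 1))
    {a : m → FermionOp Λ} (haN : ∀ i, Commute (a i) totalNumber) (haS : ∀ i, Commute (a i) HubbardWave0.spinZ)
    {P Q : Fin (K + 1) → Matrix m m ℂ}
    (hPi : ∀ u : ℝ, (∑ k : Fin (K + 1), ((u ^ (k : ℕ) : ℝ) : ℂ) • P k +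
        ((Real.exp (-u) : ℝ) : ℂ) • ∑ k : Fin (K + 1), ((u ^ (k : ℕ) : ℝ) : ℂ) • Q k).PosSemidef) :
    0 ≤ (∑ c, (sectorGibbsWeightTT' β t t' U n L c : ℂ) *
      torusAvgExpectAt L Λ'
        (∑ k : Fin (K + 1), ∑ i, ∑ j,
          ((((β ^ (k : ℕ) : ℝ) : ℂ) * P k i j) • ((fermionEmbed (PolySite.incl hΛ) (a i))ᴴ *
              (fun Y : FermionOp Λ' => (hubbardTTPrimeFermionInteraction t t' U).localHamiltonian Λ' * Y -
                  Y * (hubbardTTPrimeFermionInteraction t t' U).localHamiltonian Λ')^[(k : ℕ)]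
                (fermionEmbed (PolySite.incl hΛ) (a j))) +
            (((β ^ (k : ℕ) : ℝ) : ℂ) * Q k i j) •
              ((fun Y : FermionOp Λ' => (hubbardTTPrimeFermionInteraction t t' U).localHamiltonian Λ' * Y -
                  Y * (hubbardTTPrimeFermionInteraction t t' U).localHamiltonian Λ')^[(k : ℕ)]
                (fermionEmbed (PolySite.incl hΛ) (a j)) * (fermionEmbed (PolySite.incl hΛ) (a i))ᴴ)))
        (sectorGibbsVectorTT' t t' U n L c)).re := by
  have h₁ : Set.InjOn (Torus.proj (d := 2) L) ↑Λ' :=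
    hInj.mono (by exact_mod_cast subset_thicken Λ' 1)
  have hΛ₀ : Set.InjOn (Torus.proj (d := 2) L) ↑Λ := h₁.mono (by exact_mod_cast hΛ)
  -- the embedded generators on the torus
  set b : m → Matrix (Finset (Orb (FermionTorus 2 L))) (Finset (Orb (FermionTorus 2 L))) ℂ :=
    fun i => fermionEmbed (PolySite.toTorusEmb L hΛ₀) (a i) with hbdef
  have hb : ∀ i, fermionEmbed (PolySite.toTorusEmb L h₁) (fermionEmbed (PolySite.incl hΛ) (a i)) = b i := by
    intro i
    rw [hbdef]
    dsimp only
    rw [fermionEmbed_fermionEmbed]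
    exact congrFun (congrArg DFunLike.coe (fermionEmbed_congr fun q => rfl)) (a i)
  have hbN : ∀ i, Commute (b i) totalNumber := fun i => commute_fermionEmbed_toTorusEmb_totalNumber L hΛ₀ (haN i)
  have hbS : ∀ i, Commute (b i) HubbardWave0.spinZ := fun i => commute_fermionEmbed_toTorusEmb_spinZ L hΛ₀ (haS i)
  -- every shell up to `K` fits into the window
  have hk : ∀ k : Fin (K + 1), (fun S : Finset (Site 2) => thicken S 1)^[(k : ℕ)] Λ ⊆ Λ' := fun k =>
    (iterate_thicken_one_subset_of_le (Nat.lt_succ_iff.mp k.2) Λ).trans hK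
  -- pull the cut back into the torus
  have hΓ : fermionEmbed (PolySite.toTorusEmb L h₁)
      (∑ k : Fin (K + 1), ∑ i, ∑ j,
          ((((β ^ (k : ℕ) : ℝ) : ℂ) * P k i j) • ((fermionEmbed (PolySite.incl hΛ) (a i))ᴴ *
              (fun Y : FermionOp Λ' => (hubbardTTPrimeFermionInteraction t t' U).localHamiltonian Λ' * Y -
                  Y * (hubbardTTPrimeFermionInteraction t t' U).localHamiltonian Λ')^[(k : ℕ)]
                (fermionEmbed (PolySite.incl hΛ) (a j))) +
            (((β ^ (k : ℕ) : ℝ) : ℂ) * Q k i j) •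
              ((fun Y : FermionOp Λ' => (hubbardTTPrimeFermionInteraction t t' U).localHamiltonian Λ' * Y -
                  Y * (hubbardTTPrimeFermionInteraction t t' U).localHamiltonian Λ')^[(k : ℕ)]
                (fermionEmbed (PolySite.incl hΛ) (a j)) * (fermionEmbed (PolySite.incl hΛ) (a i))ᴴ))) =
      ∑ k : Fin (K + 1), ∑ i, ∑ j,
        ((((β ^ (k : ℕ) : ℝ) : ℂ) * P k i j) • ((b i)ᴴ *
            (fun X => hubbardTorusTT' L t t' U * X - X * hubbardTorusTT' L t t' U)^[(k : ℕ)] (b j)) +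
          (((β ^ (k : ℕ) : ℝ) : ℂ) * Q k i j) •
            ((fun X => hubbardTorusTT' L t t' U * X - X * hubbardTorusTT' L t t' U)^[(k : ℕ)] (b j) * (b i)ᴴ)) := by
    rw [fermionEmbed_sum]
    refine Finset.sum_congr rfl fun k _ => ?_
    rw [fermionEmbed_sum]
    refine Finset.sum_congr rfl fun i _ => ?_
    rw [fermionEmbed_sum]
    refine Finset.sum_congr rfl fun j _ => ?_
    rw [fermionEmbed_add, fermionEmbed_smul, fermionEmbed_smul, fermionEmbed_mul, fermionEmbed_mul,
      fermionEmbed_conjTranspose, ← iterate_hubbardTorusTT'_commutator_fermionEmbed L t t' U (k : ℕ) hΛ (hk k) hInj (a j),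
      hb, hb]
  -- each translate is nonnegative
  have hv : ∀ v : TorusSite 2 L, 0 ≤ ∑ c, sectorGibbsWeightTT' β t t' U n L c *
      (expect (∑ k : Fin (K + 1), ∑ i, ∑ j,
        ((((β ^ (k : ℕ) : ℝ) : ℂ) * P k i j) • ((b i)ᴴ *
            (fun X => hubbardTorusTT' L t t' U * X - X * hubbardTorusTT' L t t' U)^[(k : ℕ)] (b j)) +
          (((β ^ (k : ℕ) : ℝ) : ℂ) * Q k i j) •
            ((fun X => hubbardTorusTT' L t t' U * X - X * hubbardTorusTT' L t t' U)^[(k : ℕ)] (b j) * (b i)ᴴ)))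
        ((fockTranslate v).val *ᵥ sectorGibbsVectorTT' t t' U n L c)).re := fun v =>
    sum_sectorGibbsWeightTT'_mul_re_expect_momentCut_fockTranslate_nonneg L t t' U n β v hbN hbS hPi
  have hcast : ((Fintype.card (TorusSite 2 L) : ℂ))⁻¹ = (((Fintype.card (TorusSite 2 L) : ℝ)⁻¹ : ℝ) : ℂ) := by
    push_cast; rfl
  simp_rw [torusAvgExpectAt_of_injOn L h₁, hΓ]
  rw [Complex.re_sum]
  simp_rw [hcast, ← mul_assoc, ← Complex.ofReal_mul, Complex.re_ofReal_mul, Complex.re_sum, Finset.mul_sum]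
  rw [Finset.sum_comm]
  refine Finset.sum_nonneg fun v _ => ?_
  have hfac : ∀ (g : Fin (sectorGibbsCount n L) → ℝ),
      ∑ c, sectorGibbsWeightTT' β t t' U n L c * (Fintype.card (TorusSite 2 L) : ℝ)⁻¹ * g c =
        (Fintype.card (TorusSite 2 L) : ℝ)⁻¹ * ∑ c, sectorGibbsWeightTT' β t t' U n L c * g c := by
    intro g
    rw [Finset.mul_sum]
    exact Finset.sum_congr rfl fun c _ => by ring
  rw [hfac]
  exact mul_nonneg (inv_nonneg.2 (Nat.cast_nonneg _)) (hv v)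

end TorusAverage

/-! ### §2 KMS moment rows of thermal torus-limit states -/

namespace InfVolFermionState

variable {m : Type*} [Fintype m]

/-- **KMS moment cuts of thermal torus limits.** Let `ω` be a torus limit of the canonical Gibbs states of
`hubbardTorusTT' (Ls j) t t' U` at inverse temperature `β` on the sectors `(rectN n (Ls j), S^z = 0)` along
`Ls → ∞`. Then for every region `Λ`, every window `Λ' ⊇ Λ` containing the `K`-th king-move shell
`(thicken · 1)^[K] Λ`, every finite family of local generators `a_i ∈ 𝔄_Λ` conserving the local particle
number and `S^z`, and all coefficient matrices `P, Q : Fin (K+1) → Matrix m m ℂ` with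
`Σ_k u^k P_k + e^{−u} Σ_k u^k Q_k ⪰ 0` for all real `u`:
`0 ≤ Re ω_{Λ'}(Σ_k Σ_{ij} β^k [(P_k)_{ij} · (Γa_i)ᴴ ad_{H^{tt'}_{Λ'}}^k(Γa_j) + (Q_k)_{ij} · ad_{H^{tt'}_{Λ'}}^k(Γa_j) (Γa_i)ᴴ])`,
`Γ = Γ_{Λ⊆Λ'}`, `ad_H(X) = HX − XH` — the KMS MOMENT CUTS (all linear β-KMS constraints on the two-sided
spectral moment data of the generators up to order `K`) hold for thermal torus limits with gauge-invariant
generators; `K = 1` are the matrix energy–entropy-balance cuts of `TorusGibbsMatrixCuts.lean`.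
[cite: FawziFawziScalet2024, Thm. 3.4] [cite: ItoiEtAl2023, Lemma 5] -/
theorem IsTorusLimitOfMixture.re_expect_momentCut_nonneg_of_sectorGibbs
    (t t' U : ℝ) {n : ℝ} (β : ℝ) {ω : InfVolFermionState 2} {Ls : ℕ → ℕ}
    (h : ω.IsTorusLimitOfMixture (sectorGibbsCount n) (fun L => sectorGibbsWeightTT' β t t' U n L)
      (fun L => sectorGibbsVectorTT' t t' U n L) Ls)
    (hLs : Tendsto Ls atTop atTop) {Λ Λ' : Finset (Site 2)} (hΛ : Λ ⊆ Λ') {K : ℕ}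
    (hK : (fun S : Finset (Site 2) => thicken S 1)^[K] Λ ⊆ Λ')
    {a : m → FermionOp Λ} (haN : ∀ i, Commute (a i) totalNumber) (haS : ∀ i, Commute (a i) HubbardWave0.spinZ)
    {P Q : Fin (K + 1) → Matrix m m ℂ}
    (hPi : ∀ u : ℝ, (∑ k : Fin (K + 1), ((u ^ (k : ℕ) : ℝ) : ℂ) • P k +
        ((Real.exp (-u) : ℝ) : ℂ) • ∑ k : Fin (K + 1), ((u ^ (k : ℕ) : ℝ) : ℂ) • Q k).PosSemidef) :
    0 ≤ (ω.expect Λ'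
      (∑ k : Fin (K + 1), ∑ i, ∑ j,
        ((((β ^ (k : ℕ) : ℝ) : ℂ) * P k i j) • ((fermionEmbed (PolySite.incl hΛ) (a i))ᴴ *
            (fun Y : FermionOp Λ' => (hubbardTTPrimeFermionInteraction t t' U).localHamiltonian Λ' * Y -
                Y * (hubbardTTPrimeFermionInteraction t t' U).localHamiltonian Λ')^[(k : ℕ)]
              (fermionEmbed (PolySite.incl hΛ) (a j))) +
          (((β ^ (k : ℕ) : ℝ) : ℂ) * Q k i j) •
            ((fun Y : FermionOp Λ' => (hubbardTTPrimeFermionInteraction t t' U).localHamiltonian Λ' * Y -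
                Y * (hubbardTTPrimeFermionInteraction t t' U).localHamiltonian Λ')^[(k : ℕ)]
              (fermionEmbed (PolySite.incl hΛ) (a j)) * (fermionEmbed (PolySite.incl hΛ) (a i))ᴴ)))).re := by
  refine ge_of_tendsto ((Complex.continuous_re.tendsto _).comp (h Λ' _)) ?_
  filter_upwards [eventually_injOn_proj_of_tendsto (thicken Λ' 1) hLs, hLs.eventually_ge_atTop 1]
    with j hInj hj
  haveI : NeZero (Ls j) := ⟨by omega⟩
  rw [Function.comp_apply]
  simp_rw [torusAvgExpect_eq]
  exact re_sum_sectorGibbsWeightTT'_mul_torusAvgExpectAt_momentCut_nonneg (Ls j) t t' U n β hΛ hK hInj haN haS hPi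

/-- **Scalar KMS moment rows of thermal torus limits.** Same torus-limit object; for a single local
generator `a ∈ 𝔄_Λ` conserving the local `N` and `S^z`, a window `Λ' ⊇ (thicken · 1)^[K] Λ`, and real
coefficients `p_k, q_k` (`k ≤ K`) whose exponential polynomial is nonnegative on the WHOLE line,
`0 ≤ Σ_k p_k u^k + e^{−u} Σ_k q_k u^k` for every real `u`:
`0 ≤ Re ω_{Λ'}(Σ_k β^k [p_k · (Γa)ᴴ ad_{H^{tt'}_{Λ'}}^k(Γa) + q_k · ad_{H^{tt'}_{Λ'}}^k(Γa) (Γa)ᴴ])` — the rows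
`Σ_k β^k p_k ω(a† C_a^k) + Σ_k β^k q_k ω(C_a^k a†) ≥ 0`, `C_a^k = [H,[H,…[H,a]…]]`, of Itoi–Ishimori–Sato–Sakamoto
type (`K = 1`, `p = (−s, 1)`, `q = (e^{s−1}, 0)`: the linearised energy–entropy-balance row of
`InfVolFermionStateTorusLimitEnergyEntropyBalance.lean`). [cite: ItoiEtAl2023, Theorem 3]
[cite: FawziFawziScalet2024, Thm. 3.1] -/
theorem IsTorusLimitOfMixture.re_expect_momentRow_nonneg_of_sectorGibbs
    (t t' U : ℝ) {n : ℝ} (β : ℝ) {ω : InfVolFermionState 2} {Ls : ℕ → ℕ}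
    (h : ω.IsTorusLimitOfMixture (sectorGibbsCount n) (fun L => sectorGibbsWeightTT' β t t' U n L)
      (fun L => sectorGibbsVectorTT' t t' U n L) Ls)
    (hLs : Tendsto Ls atTop atTop) {Λ Λ' : Finset (Site 2)} (hΛ : Λ ⊆ Λ') {K : ℕ}
    (hK : (fun S : Finset (Site 2) => thicken S 1)^[K] Λ ⊆ Λ')
    {a : FermionOp Λ} (haN : Commute a totalNumber) (haS : Commute a HubbardWave0.spinZ)
    {p q : Fin (K + 1) → ℝ}
    (hpq : ∀ u : ℝ, 0 ≤ ∑ k, p k * u ^ (k : ℕ) + Real.exp (-u) * ∑ k, q k * u ^ (k : ℕ)) :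
    0 ≤ (ω.expect Λ'
      (∑ k : Fin (K + 1),
        ((((β ^ (k : ℕ) * p k : ℝ) : ℂ)) • ((fermionEmbed (PolySite.incl hΛ) a)ᴴ *
            (fun Y : FermionOp Λ' => (hubbardTTPrimeFermionInteraction t t' U).localHamiltonian Λ' * Y -
                Y * (hubbardTTPrimeFermionInteraction t t' U).localHamiltonian Λ')^[(k : ℕ)]
              (fermionEmbed (PolySite.incl hΛ) a)) +
          (((β ^ (k : ℕ) * q k : ℝ) : ℂ)) •
            ((fun Y : FermionOp Λ' => (hubbardTTPrimeFermionInteraction t t' U).localHamiltonian Λ' * Y -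
                Y * (hubbardTTPrimeFermionInteraction t t' U).localHamiltonian Λ')^[(k : ℕ)]
              (fermionEmbed (PolySite.incl hΛ) a) * (fermionEmbed (PolySite.incl hΛ) a)ᴴ)))).re := by
  have h' := h.re_expect_momentCut_nonneg_of_sectorGibbs t t' U β hLs hΛ hK (a := fun _ : Unit => a)
    (fun _ => haN) (fun _ => haS)
    (P := fun k => ((p k : ℝ) : ℂ) • (1 : Matrix Unit Unit ℂ))
    (Q := fun k => ((q k : ℝ) : ℂ) • (1 : Matrix Unit Unit ℂ)) fun u => posSemidef_momentCut_unit_of_nonneg (hpq u)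
  rwa [momentCut_unit_eq] at h'

end InfVolFermionState

end Literature.MathematicalPhysics.QuantumLattice

end
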